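import Summits.ABC.ABC.Theses.FeketeScales
import Summits.ABC.ABC.Theorems.FeketeScalesSubmultOfRST
import Summits.ABC.ABC.Theorems.FeketeScalesScaleSubmultiplicativityNonBurstSubmult
import Summits.ABC.ABC.Theorems.FeketeScalesScaleSubmultiplicativityDyadicHereditaryFactorisation
import Summits.ABC.ABC.Theorems.FeketeScalesScaleSubmultiplicativityStewartYuSlackSubmult
import Summits.ABC.ABC.Theorems.FeketeScalesScaleSubmultiplicativityPowerShapeDescent
import Summits.ABC.ABC.Theorems.FeketeScalesScaleSubmultiplicativityOfEnvelopeOfPowerShapes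

/-!
# Crux stmt-ABC-2160 `ScaleSubmultiplicativity` — lead skeleton, line `SketchIdeator3` (card core-lattice-dichotomy)

Lead prover-line-stmt-ABC-2160-0, 2026-08-16 (revision 3: stubs S1–S4, S7 LANDED and imported); taken over
UNCHANGED by lead c1 (prover-line-stmt-ABC-2160-c1-0), 2026-08-17, and again UNCHANGED by lead c2
(prover-line-stmt-ABC-2160-c2-0), 2026-08-17T02Z, and again UNCHANGED by lead c3
(prover-line-stmt-ABC-2160-c3-0), 2026-08-17T02:3xZ — re-checked rc 0 with exactly the two stub `sorry`s S5/S6 below; both stubs sit below `Literature.Barriers.ABC.RSTConjectureAUpper` (`@[conjecture]`):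
kernel facts `stubP_of_rstConjectureAUpper`, `stubW_of_rstConjectureAUpper`, `abcOnPrimitive_of_stubP` in
`Cruxes/ScaleSubmultiplicativity/Disproof.lean` §5.  Composition of the
picked line (its `LineComposition`):

  NON-BURSTS ARE FREE (S1) + PRIMITIVE SUB-POWER ENVELOPE (S5, stub (P)) + CRUX ON POWER SHAPES (S6, stub (W))
    ⟹ `Summit.ABC.ABC.Theses.FeketeScales.ScaleSubmultiplicativity`

by the case split power-shape / not, `θ := max θ_P θ_W`, `K := max (16 e^B) K_W`, `R₀ := max 4 R₀_W`
(theorem `scaleSubmultiplicativity_of_envelope_of_powerShapes`, sorry-free below).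

Registered stubs and their state:
* S1 `ScaleSubmultiplicativity.nonBurst_submult` — LANDED p96241
  (`Summits/ABC/ABC/Theorems/FeketeScalesScaleSubmultiplicativityNonBurstSubmult.lean`), imported.
* S2 `ScaleSubmultiplicativity.dyadic_hereditary_factorisation` — LANDED p96365
  (`…DyadicHereditaryFactorisation.lean`), imported (in-core shadow identity `D_{2d} = D_d ⊗ S_d`, serves (W)).
* S3 `ScaleSubmultiplicativity.stewartYu_slack_submult` — LANDED p96321 (`…StewartYuSlackSubmult.lean`),
  imported (calibration: the crux with Stewart–Yu slack, conditional on the named fact `stewart_yu`).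
* S4 `ScaleSubmultiplicativity.powerShape_descent` — LANDED p96641 (`…PowerShapeDescent.lean`), imported
  (card power-shape-cyclotomic-descent first lemma: `rad(T'')·rad(Φ) ≤ n·rad(T)`, `z^n ≤ zΦ ≤ n z^n`).
* S5 `ScaleSubmultiplicativity.primitive_subpower_envelope` — OPEN (stub (P), the card's declared residual:
  sub-power envelope on non-power-shape triples; RST-lite; no mechanism known).
* S7 `ScaleSubmultiplicativity.of_primitiveEnvelope_of_powerShapeSubmult` — LANDED p97123
  (`…OfEnvelopeOfPowerShapes.lean`), imported: the line's transfer (P) ∧ (W) ⟹ crux by name.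
* S6 `ScaleSubmultiplicativity.powerShape_submult` — OPEN (stub (W), crux on power shapes; wave-1 worker:
  `stub-blocked: Literature.Barriers.ABC.RSTConjectureAUpper`; sharpest open special case = the Mersenne orbit
  `(1, 2^m - 1, 2^m)` at the split `(R₀, ⌈2 rad/R₀⌉)`, which already needs the sub-power Mersenne-excess bound
  `log((2^m-1)/rad(2^m-1)) ≤ (m log 2)^θ + O(1)`, itself implying crux `PrimePowerRadical` at `q = 2`).
All statements are over tree vocabulary only (`IsABCTriple`, `rad`); the power-shape predicate and `SubmultAt` of
the planner's sketch are INLINED so that every stub is a self-contained theorem.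
-/

-- `Summit.<Summit>.<Problem>` is the mandated summit-side namespace (CONVENTIONS §2); for the
-- single-conjunct summit `ABC` the two coincide, so the duplicate `ABC.ABC` is deliberate.
set_option linter.dupNamespace false

namespace Summit.ABC.ABC.Theorems

open Literature.NumberTheory.DiophantineGeometry

/-! ### S5 — stub (P): the primitive sub-power envelope (OPEN; the line's declared residual) -/

/-- STUB S5, (P) `PrimitiveSubpowerEnvelope` (card core-lattice-dichotomy): some `θ ∈ [0,1)` and `B` with
`c ≤ e^B · rad · exp((log rad)^θ)` for every abc triple that is NOT of power shape (no two of `a, b, c` are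
perfect `j`-th powers for one `j ≥ 2`).  OPEN — RST-lite on a co-thin set of triples (it contains Reyssat's
triple and every known record family); strictly weaker than the hypothesis of `SubmultOfRST`, which asks it for
all triples; the desert lemma of the card (BarrierNotesIdeator3 §A5(iii)) says every proof of the crux must
contain it.  Sources: RobertStewartTenenbaum2014 Conj. A (model), Literature.Barriers.ABC.BakerMethodBounds (why no
tool acts on it). -/
theorem ScaleSubmultiplicativity.primitive_subpower_envelope :
    ∃ θ : ℝ, 0 ≤ θ ∧ θ < 1 ∧ ∃ B : ℝ, ∀ a b c : ℕ, IsABCTriple a b c →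
      ¬ (∃ j : ℕ, 2 ≤ j ∧ ((∃ x y : ℕ, a = x ^ j ∧ b = y ^ j) ∨ (∃ x z : ℕ, a = x ^ j ∧ c = z ^ j) ∨
          (∃ y z : ℕ, b = y ^ j ∧ c = z ^ j))) →
      (c : ℝ) ≤ Real.exp B * (rad a b c : ℝ) * Real.exp (Real.log (rad a b c : ℝ) ^ θ) := by
  sorry

/-! ### S6 — stub (W): the crux on power shapes (OPEN) -/

/-- STUB S6, (W) `PowerShapeSubmult` (card core-lattice-dichotomy): the crux restricted to POWER-SHAPED triples
(two of `a, b, c` perfect `j`-th powers, `j ≥ 2`), with `θ ∈ [0,1)`.  OPEN — by the hereditary shadows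
(S2, S4) it reduces orbit by orbit to sub-power control of the Wieferich excess `Φ/rad Φ` of complementary
cyclotomic cofactors, unknown even for `2^n - 1` (best: `log rad(u_n) ≫ (log n)²/log log n`, Shorey 1983 /
Stewart 2013).  Sources: card power-shape-cyclotomic-descent (`CyclotomicPowerfulSubpower`), BarrierNotesIdeator3
§B2. -/
theorem ScaleSubmultiplicativity.powerShape_submult :
    ∃ θ : ℝ, 0 ≤ θ ∧ θ < 1 ∧ ∃ K : ℝ, 0 < K ∧ ∃ R₀ : ℕ, ∀ R₁ R₂ : ℕ, R₀ ≤ R₁ → R₀ ≤ R₂ →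
      ∀ a b c : ℕ, IsABCTriple a b c →
      (∃ j : ℕ, 2 ≤ j ∧ ((∃ x y : ℕ, a = x ^ j ∧ b = y ^ j) ∨ (∃ x z : ℕ, a = x ^ j ∧ c = z ^ j) ∨
          (∃ y z : ℕ, b = y ^ j ∧ c = z ^ j))) →
      rad a b c ≤ R₁ * R₂ →
      ∃ a₁ b₁ c₁ a₂ b₂ c₂ : ℕ, IsABCTriple a₁ b₁ c₁ ∧ rad a₁ b₁ c₁ ≤ R₁ ∧ IsABCTriple a₂ b₂ c₂ ∧
        rad a₂ b₂ c₂ ≤ R₂ ∧ (c : ℝ) ≤ K * Real.exp (Real.log ((R₁ : ℝ) * R₂) ^ θ) * c₁ * c₂ := by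
  sorry

/-! ### Composition: the landed transfer S7 applied to S5 and S6 — the crux, by name -/

/-- **Line composition** (card core-lattice-dichotomy): the LANDED transfer S7
`ScaleSubmultiplicativity.of_primitiveEnvelope_of_powerShapeSubmult` (p97123,
`Summits/ABC/ABC/Theorems/FeketeScalesScaleSubmultiplicativityOfEnvelopeOfPowerShapes.lean`: (P) ∧ (W) ⟹ crux,
via the landed rung S1 and monotonicity in `(θ, K)`) applied to the two open stubs (P) = S5 and (W) = S6 gives
`ScaleSubmultiplicativity` BY NAME.  The open content of the line sits entirely in S5 and S6. -/
theorem scaleSubmultiplicativity_of_envelope_of_powerShapes :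
    Summit.ABC.ABC.Theses.FeketeScales.ScaleSubmultiplicativity :=
  ScaleSubmultiplicativity.of_primitiveEnvelope_of_powerShapeSubmult
    ScaleSubmultiplicativity.primitive_subpower_envelope ScaleSubmultiplicativity.powerShape_submult

end Summit.ABC.ABC.Theorems
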